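import Literature.Analysis.FluidPDE.TypeIAncientMild
import Summits.NavierStokesRegularity.NavierStokesRegularity.Theorems.SqueezeCycleExtremalElementExistsRescale
import Summits.NavierStokesRegularity.NavierStokesRegularity.Theorems.SqueezeCycleExtremalElementExistsExtraction
import HarnessLib

/-!
# `SymmetricLiouville` (crux stmt-NavierStokesRegularity-4053), line `blowdown-kills-pitch`,
# stub `stub_rssFarFieldVanishing`: the profile of a (rotated) self-similar element of `A_C` vanishes at infinity

Support file (everything proved, kind = proof) for the lead's skeleton of the line `blowdown-kills-pitch`
(`Cruxes/SymmetricLiouville/Lines/blowdown-kills-pitch.lean`). Statement (verbatim the registered stub): given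
the periodic Type-I ancient Liouville theorem at constant `C` (hypothesis; proved by the line as
`periodicTypeIAncientLiouville`), every element `u` of the Type-I ancient mild class `A_C` (`IsTypeIAncientMild C u`)
annihilated by a spiral-scaling generator about the space–time origin, `∇u·(x + Ax) + u + 2t∂ₜu − Au = 0` with
`A` skew (possibly `0`), is SMALL FAR FROM THE CENTRE at the scale-invariant rate: for every `ε > 0` there is `R`
with `√(−t)‖u(t, x)‖ ≤ ε` whenever `‖x‖ ≥ R√(−t)`. In profile terms (`u(t,x) = (−t)^{-1/2}e^{…A}U(x/√(−t))`):
the bounded profile `U` tends to `0` at infinity. This is the far-field recentring step "B1" of the crux idea cards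
`farfield-recentring-critical-rate` / `stabiliser-at-infinity-decay` / `degenerate-stabiliser-zoom`, for the
spiral leaf, with constants depending on `(u, A)` (no uniformity in the rotation rate is claimed — the
disprover's cycle-2 uniformity caveat).

Proof (recentring at far violators, KNSS 2009 §6-type argument): if not, pick `t_n < 0`, `x_n` with
`‖x_n‖ ≥ (n+1)√(−t_n)` and `√(−t_n)‖u(t_n, x_n)‖ > ε`; the zooms `w_n(s, y) = λ_n u(λ_n²s, x_n + λ_n y)`,
`λ_n = √(−t_n)`, lie in `A_C` (`Theorems.isTypeIAncientMild_zoom`) with `‖w_n(−1, 0)‖ > ε`, and the symmetry of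
`u` reads, for `w_n`, `∇w_n(s,y)·p_n = −λ_n E_n(s,y)` with `p_n = x_n + Ax_n` (`‖p_n‖ ≥ ‖x_n‖ ≥ (n+1)λ_n` by
skewness) and `E_n = ∇w_n·(y + Ay) + w_n + 2s∂ₛw_n − Aw_n` bounded at each `(s, y)` uniformly in `n` by the
class-uniform bounds of KNSS Prop. 4.1 (`Theorems.exists_norm_iteratedFDeriv_le_of_typeI`,
`Theorems.exists_lipschitz_time_of_typeI`); so `∇w_n·(p_n/‖p_n‖) → 0` pointwise. Along the subsequence of the
`C¹_loc` compactness theorem (`Theorems.exists_tendsto_of_isTypeIAncientMild_seq`, gradients converge) and a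
further subsequence with `p_n/‖p_n‖ → b`, `‖b‖ = 1`, the limit `W ∈ A_C` has `∇W·b ≡ 0`, hence is `b`-periodic,
hence `0` by the periodic Liouville hypothesis — contradicting `‖W(−1, 0)‖ ≥ ε`.
[cite: KochNadirashviliSereginSverak2009, proof of Thm 6.2 (arXiv:0709.3599 p. 13)]
-/

noncomputable section

set_option linter.dupNamespace false

open Set Function Filter MeasureTheory
open scoped Topology NNReal

namespace Summit.NavierStokesRegularity.NavierStokesRegularity.Theorems.SymmetryModuliCountSymmetricLiouville

open Literature.Analysis Literature.Analysis.FluidPDE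

/-- Local notation for physical space `ℝ³`. -/
local notation "E3" => EuclideanSpace ℝ (Fin 3)

/-! ### Calculus helpers on the class -/

/-- Time slices of a class element are differentiable in time at every negative time. -/
theorem differentiableAt_time {C : ℝ} {u : ℝ → E3 → E3} (hu : IsTypeIAncientMild C u) {t : ℝ}
    (ht : t < 0) (x : E3) : DifferentiableAt ℝ (fun r => u r x) t := by
  have h1 : ContDiffAt ℝ (⊤ : ℕ∞) (uncurry u) (t, x) :=
    hu.contDiffOn.contDiffAt ((isOpen_Iio.prod isOpen_univ).mem_nhds ⟨ht, mem_univ _⟩)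
  have h2 : ContDiffAt ℝ (⊤ : ℕ∞) (fun r : ℝ => (r, x)) t := (contDiff_id.prodMk contDiff_const).contDiffAt
  exact (h1.comp t h2).differentiableAt (by simp)

/-- A field whose gradient annihilates a fixed vector `b` on a slice is invariant under translations along
`b` on that slice (mean value theorem along the line). -/
theorem periodic_of_fderiv_apply_eq_zero {v : E3 → E3} (hv : Differentiable ℝ v) (b : E3)
    (h : ∀ y, fderiv ℝ v y b = 0) (y : E3) : v (y + b) = v y := by
  set g : ℝ → E3 := fun θ => v (y + θ • b) with hg
  have hline : ∀ θ : ℝ, HasDerivAt (fun r : ℝ => y + r • b) b θ := by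
    intro θ
    have h := ((hasDerivAt_id θ).smul_const b).const_add y
    simpa using h
  have hgd : ∀ θ, HasDerivAt g 0 θ := by
    intro θ
    have hd := (hv (y + θ • b)).hasFDerivAt.comp_hasDerivAt θ (hline θ)
    rw [h (y + θ • b)] at hd
    exact hd
  have hconst : g 1 = g 0 :=
    is_const_of_deriv_eq_zero (fun θ => (hgd θ).differentiableAt) (fun θ => (hgd θ).deriv) 1 0
  simpa [hg] using hconst

/-- **Class-uniform bounds at a fixed negative time** (KNSS 2009 Prop. 4.1 in the tree's class-uniform form):
for `s < 0` there are `K₁, L` such that every element `w` of `A_C` satisfies `‖∇w(s, y)‖ ≤ K₁` and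
`‖∂ₛw(s, y)‖ ≤ L` for all `y`. [cite: KochNadirashviliSereginSverak2009, Prop. 4.1 (arXiv:0709.3599 p. 8)] -/
theorem exists_gradient_timeDeriv_bounds (C : ℝ) {s : ℝ} (hs : s < 0) :
    ∃ K₁ L : ℝ, ∀ w : ℝ → E3 → E3, IsTypeIAncientMild C w → ∀ y,
      ‖fderiv ℝ (w s) y‖ ≤ K₁ ∧ ‖timeDeriv w s y‖ ≤ L := by
  have hab : s - 2 < s / 2 := by linarith
  have hb : s / 2 < 0 := by linarith
  obtain ⟨K₁, hK₁⟩ := exists_norm_iteratedFDeriv_le_of_typeI C 1 hab hb one_pos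
  obtain ⟨L, hL0, hL⟩ := exists_lipschitz_time_of_typeI C 0 hab hb one_pos
  have hsI : s ∈ Ico (s - 2 + 1) (s / 2) := ⟨by linarith, by linarith⟩
  refine ⟨K₁, L, fun w hw y => ⟨?_, ?_⟩⟩
  · have h := hK₁ hw.continuousOn_uncurry (fun t ht => hw.isWeaklyDivFree ht)
      (fun s' t hst ht x => hw.mild_eq_heatExtension hst ht x) hw.hasTypeITimeDecay s hsI y
    rwa [norm_iteratedFDeriv_one] at h
  · -- the time slice through `y` is `L`-Lipschitz on a window around `s`
    have hlip : LipschitzOnWith (Real.toNNReal L) (fun r => w r y) (Ioo (s - 1) (s / 2)) := by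
      refine LipschitzOnWith.of_dist_le_mul fun t ht t' ht' => ?_
      have h := hL hw.continuousOn_uncurry (fun t ht => hw.isWeaklyDivFree ht)
        (fun s' t hst ht x => hw.mild_eq_heatExtension hst ht x) hw.hasTypeITimeDecay
        t' ⟨by linarith [ht'.1], ht'.2⟩ t ⟨by linarith [ht.1], ht.2⟩ y
      simp only [iteratedFDeriv_zero_eq_comp, comp_apply] at h
      rw [← map_sub, LinearIsometryEquiv.norm_map] at h
      rw [dist_eq_norm, Real.dist_eq, Real.coe_toNNReal L hL0]
      exact h
    have hnhds : Ioo (s - 1) (s / 2) ∈ 𝓝 s := Ioo_mem_nhds (by linarith) (by linarith)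
    have h := norm_deriv_le_of_lipschitzOn hnhds hlip
    rw [Real.coe_toNNReal L hL0] at h
    rwa [timeDeriv_apply]

/-! ### The recentred symmetry identity -/

/-- **The spiral symmetry seen from a far point.** If `u ∈ A_C` satisfies `∇u·(x + Ax) + u + 2t∂ₜu − Au = 0`
on `t < 0`, then its zoom `w(s, y) = c·u(c²s, x₀ + c y)` about `(0, x₀)` satisfies, for `s < 0`,
`∇w(s, y)·(x₀ + Ax₀) = −c·(∇w(s,y)·(y + Ay) + w(s,y) + 2s∂ₛw(s,y) − Aw(s,y))`. -/
theorem fderiv_zoom_apply_centre {C : ℝ} {u : ℝ → E3 → E3} (hu : IsTypeIAncientMild C u)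
    (A : E3 →L[ℝ] E3)
    (hL : ∀ t < 0, ∀ x, fderiv ℝ (u t) x (x + A x) + u t x + (2 * t) • timeDeriv u t x - A (u t x) = 0)
    {c : ℝ} (hc : 0 < c) (x₀ : E3) {s : ℝ} (hs : s < 0) (y : E3) :
    fderiv ℝ ((c • stPull (c ^ 2) c 0 x₀ u) s) y (x₀ + A x₀) =
      -c • (fderiv ℝ ((c • stPull (c ^ 2) c 0 x₀ u) s) y (y + A y) + (c • stPull (c ^ 2) c 0 x₀ u) s y +
        (2 * s) • timeDeriv (c • stPull (c ^ 2) c 0 x₀ u) s y - A ((c • stPull (c ^ 2) c 0 x₀ u) s y)) := by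
  set T : ℝ := c ^ 2 * s with hT
  set X : E3 := x₀ + c • y with hX
  have hTneg : T < 0 := mul_neg_of_pos_of_neg (pow_pos hc 2) hs
  have hd : Differentiable ℝ (u (c ^ 2 * s)) := (hu.contDiff_slice hTneg).differentiable (by simp)
  -- the three pieces of the zoomed field
  have hD : fderiv ℝ ((c • stPull (c ^ 2) c 0 x₀ u) s) y = (c ^ 2) • fderiv ℝ (u T) X := fderiv_zoom x₀ u hd y
  have hV : (c • stPull (c ^ 2) c 0 x₀ u) s y = c • u T X := zoom_apply c x₀ u s y
  have hτ : timeDeriv (c • stPull (c ^ 2) c 0 x₀ u) s y = (c * c ^ 2) • timeDeriv u T X := by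
    have h1 : timeDeriv (c • stPull (c ^ 2) c 0 x₀ u) s y = c • timeDeriv (stPull (c ^ 2) c 0 x₀ u) s y := by
      simp only [timeDeriv_apply]
      have hdiff : DifferentiableAt ℝ (fun r => stPull (c ^ 2) c 0 x₀ u r y) s := by
        simp only [stPull_apply, zero_add]
        have h2 : DifferentiableAt ℝ (fun r => u r X) (c ^ 2 * s) := differentiableAt_time hu hTneg X
        exact h2.comp s ((differentiableAt_id.const_mul (c ^ 2)))
      exact deriv_const_smul c hdiff
    rw [h1, timeDeriv_stPull, zero_add, mul_smul]
  -- the clause at `(T, X)`, with `X + AX = (x₀ + Ax₀) + c(y + Ay)`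
  have key := hL T hTneg X
  have hsplit : X + A X = (x₀ + A x₀) + c • (y + A y) := by
    simp only [hX, map_add, map_smul, smul_add]
    abel
  rw [hsplit, map_add, map_smul] at key
  rw [hD, hV, hτ]
  simp only [smul_apply, map_smul, smul_smul, hT]
  -- linear algebra: multiply the clause by `c²`
  have key2 := congrArg (fun z => (c ^ 2) • z) key
  simp only [smul_zero, smul_add, smul_sub, smul_smul] at key2
  rw [← sub_eq_zero]
  rw [← key2]
  module

/-! ### The registered stub -/

/-- **Stub — the profile of a (rotated) self-similar element of `A_C` vanishes at infinity** (verbatim the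
registered stub `stub_rssFarFieldVanishing` of line `blowdown-kills-pitch`): given the periodic Type-I ancient
Liouville theorem at constant `C`, an element of `A_C` annihilated by `∇u·(x + Ax) + u + 2t∂ₜu − Au` (`A`
skew) satisfies `√(−t)‖u(t,x)‖ ≤ ε` for `‖x‖ ≥ R(ε)√(−t)`. [cite: KochNadirashviliSereginSverak2009, proof of Thm 6.2 (arXiv:0709.3599 p. 13)] -/
theorem stub_rssFarFieldVanishing :
    ∀ C : ℝ,
      (∀ u : ℝ → E3 → E3, IsTypeIAncientMild C u → ∀ e : E3, e ≠ 0 →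
          (∀ t < 0, ∀ x, u t (x + e) = u t x) → ∀ t < 0, ∀ x, u t x = 0) →
      ∀ u : ℝ → E3 → E3, IsTypeIAncientMild C u →
        ∀ A : E3 →L[ℝ] E3, (∀ x, inner ℝ (A x) x = 0) →
          (∀ t < 0, ∀ x, fderiv ℝ (u t) x (x + A x) + u t x + (2 * t) • timeDeriv u t x - A (u t x) = 0) →
          ∀ ε > 0, ∃ R : ℝ, ∀ t < 0, ∀ x, R * Real.sqrt (-t) ≤ ‖x‖ → Real.sqrt (-t) * ‖u t x‖ ≤ ε := by
  intro C hPL u hu A hA hL ε hε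
  by_contra hcon
  push Not at hcon
  -- violators with `‖x_n‖ ≥ (n+1)√(-t_n)`
  have hch : ∀ n : ℕ, ∃ tx : ℝ × E3, tx.1 < 0 ∧ ((n : ℝ) + 1) * Real.sqrt (-tx.1) ≤ ‖tx.2‖ ∧
      ε < Real.sqrt (-tx.1) * ‖u tx.1 tx.2‖ := by
    intro n
    obtain ⟨t, ht, x, hx, hbig⟩ := hcon ((n : ℝ) + 1)
    exact ⟨(t, x), ht, hx, hbig⟩
  choose tx htneg hfar hbig using hch
  set tn : ℕ → ℝ := fun n => (tx n).1 with htn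
  set xn : ℕ → E3 := fun n => (tx n).2 with hxn
  -- scales
  set lam : ℕ → ℝ := fun n => Real.sqrt (-(tn n)) with hlam
  have hlam0 : ∀ n, 0 < lam n := fun n => Real.sqrt_pos.2 (neg_pos.2 (htneg n))
  have hlam2 : ∀ n, lam n ^ 2 = -(tn n) := fun n => Real.sq_sqrt (neg_nonneg.2 (htneg n).le)
  -- the recentring vectors `p_n = x_n + A x_n`, `‖p_n‖ ≥ ‖x_n‖ ≥ (n+1) λ_n`
  set p : ℕ → E3 := fun n => xn n + A (xn n) with hp
  have hskew : ∀ x : E3, ‖x‖ ≤ ‖x + A x‖ := by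
    intro x
    have h0 : inner ℝ x (A x) = 0 := by rw [real_inner_comm]; exact hA x
    have h1 : ‖x + A x‖ ^ 2 = ‖x‖ ^ 2 + ‖A x‖ ^ 2 := by
      rw [norm_add_sq_real, h0]; ring
    have h2 : ‖x‖ ^ 2 ≤ ‖x + A x‖ ^ 2 := by rw [h1]; exact le_add_of_nonneg_right (sq_nonneg _)
    exact (sq_le_sq₀ (norm_nonneg _) (norm_nonneg _)).1 h2
  have hp_ge : ∀ n : ℕ, ((n : ℝ) + 1) * lam n ≤ ‖p n‖ := fun n => (hfar n).trans (hskew (xn n))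
  have hp_pos : ∀ n, 0 < ‖p n‖ := fun n =>
    lt_of_lt_of_le (mul_pos (by positivity) (hlam0 n)) (hp_ge n)
  have hratio : ∀ n : ℕ, lam n / ‖p n‖ ≤ 1 / ((n : ℝ) + 1) := by
    intro n
    rw [div_le_div_iff₀ (hp_pos n) (by positivity), one_mul, mul_comm]
    exact hp_ge n
  -- the zooms
  set w : ℕ → ℝ → E3 → E3 := fun n => lam n • stPull (lam n ^ 2) (lam n) 0 (xn n) u with hw
  have hwcl : ∀ n, IsTypeIAncientMild C (w n) := fun n => isTypeIAncientMild_zoom hu (hlam0 n) (xn n)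
  have hw1 : ∀ n, ε < ‖w n (-1) 0‖ := by
    intro n
    have e1 : w n (-1) 0 = lam n • u (lam n ^ 2 * (-1)) (xn n + lam n • (0 : E3)) :=
      zoom_apply (lam n) (xn n) u (-1) 0
    rw [e1, smul_zero, add_zero, mul_neg_one, hlam2, neg_neg, norm_smul,
      Real.norm_of_nonneg (hlam0 n).le]
    exact hbig n
  -- the recentred identity: `∇w_n(s,y)·p_n = -λ_n E_n(s,y)`
  have hid : ∀ n, ∀ s < 0, ∀ y, fderiv ℝ (w n s) y (p n) =
      -lam n • (fderiv ℝ (w n s) y (y + A y) + w n s y + (2 * s) • timeDeriv (w n) s y - A (w n s y)) :=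
    fun n s hs y => fderiv_zoom_apply_centre hu A hL (hlam0 n) (xn n) hs y
  -- hence `‖∇w_n(s,y)·(p_n/‖p_n‖)‖ ≤ M(s,y)/(n+1)`
  have hsmallgrad : ∀ s < 0, ∀ y, ∃ M : ℝ, ∀ n,
      ‖fderiv ℝ (w n s) y (‖p n‖⁻¹ • p n)‖ ≤ M / ((n : ℝ) + 1) := by
    intro s hs y
    obtain ⟨K₁, L, hKL⟩ := exists_gradient_timeDeriv_bounds C hs
    set K₀ : ℝ := C / Real.sqrt (-s) with hK₀
    refine ⟨K₁ * ‖y + A y‖ + K₀ + 2 * |s| * L + ‖A‖ * K₀, fun n => ?_⟩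
    obtain ⟨hg, ht⟩ := hKL (w n) (hwcl n) y
    have h0 : ‖w n s y‖ ≤ K₀ := (hwcl n).norm_le hs y
    have hE : ‖fderiv ℝ (w n s) y (y + A y) + w n s y + (2 * s) • timeDeriv (w n) s y - A (w n s y)‖ ≤
        K₁ * ‖y + A y‖ + K₀ + 2 * |s| * L + ‖A‖ * K₀ := by
      refine (norm_sub_le _ _).trans (add_le_add ((norm_add_le _ _).trans (add_le_add
        ((norm_add_le _ _).trans (add_le_add ?_ h0)) ?_)) ?_)
      · exact (ContinuousLinearMap.le_opNorm _ _).trans (mul_le_mul_of_nonneg_right hg (norm_nonneg _))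
      · rw [norm_smul, Real.norm_eq_abs, abs_mul, abs_two]
        exact mul_le_mul_of_nonneg_left ht (by positivity)
      · exact (A.le_opNorm _).trans (mul_le_mul_of_nonneg_left h0 (norm_nonneg _))
    have hM0 : 0 ≤ K₁ * ‖y + A y‖ + K₀ + 2 * |s| * L + ‖A‖ * K₀ := (norm_nonneg _).trans hE
    rw [map_smul, norm_smul, norm_inv, norm_norm, hid n s hs y, norm_smul, norm_neg,
      Real.norm_of_nonneg (hlam0 n).le, ← mul_assoc, inv_mul_eq_div]
    calc lam n / ‖p n‖ * ‖fderiv ℝ (w n s) y (y + A y) + w n s y + (2 * s) • timeDeriv (w n) s y - A (w n s y)‖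
        ≤ (1 / ((n : ℝ) + 1)) * (K₁ * ‖y + A y‖ + K₀ + 2 * |s| * L + ‖A‖ * K₀) :=
          mul_le_mul (hratio n) hE (norm_nonneg _) (by positivity)
      _ = (K₁ * ‖y + A y‖ + K₀ + 2 * |s| * L + ‖A‖ * K₀) / ((n : ℝ) + 1) := by ring
  -- compactness in the class (with gradients) and on the unit sphere
  obtain ⟨φ, hφ, W, hW, hpt, hgrad, -, -⟩ := exists_tendsto_of_isTypeIAncientMild_seq C hwcl
  set b : ℕ → E3 := fun n => ‖p n‖⁻¹ • p n with hb
  have hbS : ∀ n, b n ∈ Metric.sphere (0 : E3) 1 := by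
    intro n
    rw [mem_sphere_zero_iff_norm, hb, norm_smul, norm_inv, norm_norm, inv_mul_cancel₀ (hp_pos n).ne']
  obtain ⟨b₀, hb₀S, ψ, hψ, hbψ⟩ := (isCompact_sphere (0 : E3) 1).tendsto_subseq fun n => hbS (φ n)
  have hb₀ : b₀ ≠ 0 := by
    rw [mem_sphere_zero_iff_norm] at hb₀S
    intro h; rw [h, norm_zero] at hb₀S; exact zero_ne_one hb₀S
  -- `∇W · b₀ = 0`
  have hWgrad : ∀ s < 0, ∀ y, fderiv ℝ (W s) y b₀ = 0 := by
    intro s hs y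
    obtain ⟨M, hM⟩ := hsmallgrad s hs y
    -- the evaluated gradients converge to `∇W(s,y) b₀` …
    have hev : Tendsto (fun j => fderiv ℝ (w (φ (ψ j)) s) y (b (φ (ψ j)))) atTop (𝓝 (fderiv ℝ (W s) y b₀)) := by
      have h1 : Tendsto (fun j => fderiv ℝ (w (φ (ψ j)) s) y) atTop (𝓝 (fderiv ℝ (W s) y)) :=
        (hgrad s hs y).comp hψ.tendsto_atTop
      have h2 : Tendsto (fun j => (fderiv ℝ (w (φ (ψ j)) s) y, b (φ (ψ j)))) atTop
          (𝓝 (fderiv ℝ (W s) y, b₀)) := h1.prodMk_nhds hbψ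
      exact ((isBoundedBilinearMap_apply (𝕜 := ℝ) (E := E3) (F := E3)).continuous.tendsto _).comp h2
    -- … and to `0`
    have hz : Tendsto (fun j => fderiv ℝ (w (φ (ψ j)) s) y (b (φ (ψ j)))) atTop (𝓝 0) := by
      have hMj : Tendsto (fun j : ℕ => M / (((φ (ψ j) : ℕ) : ℝ) + 1)) atTop (𝓝 0) := by
        have h1 : Tendsto (fun j : ℕ => ((φ (ψ j) : ℕ) : ℝ) + 1) atTop atTop :=
          (tendsto_natCast_atTop_atTop.comp ((hφ.comp hψ).tendsto_atTop)).atTop_add tendsto_const_nhds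
        have h2 := h1.inv_tendsto_atTop.const_mul M
        rw [mul_zero] at h2
        refine h2.congr fun j => ?_
        simp only [Pi.inv_apply, div_eq_mul_inv]
      refine squeeze_zero_norm (fun j => ?_) hMj
      exact hM (φ (ψ j))
    exact tendsto_nhds_unique hev hz
  -- hence `W` is `b₀`-periodic and vanishes
  have hWper : ∀ s < 0, ∀ y, W s (y + b₀) = W s y := fun s hs y =>
    periodic_of_fderiv_apply_eq_zero ((hW.contDiff_slice hs).differentiable (by simp)) b₀ (hWgrad s hs) y
  have hW0 : ∀ s < 0, ∀ y, W s y = 0 := hPL W hW b₀ hb₀ hWper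
  -- contradiction at `(-1, 0)`
  have hlim : Tendsto (fun j => w (φ (ψ j)) (-1) 0) atTop (𝓝 (W (-1) 0)) :=
    (hpt (-1) (by norm_num) 0).comp hψ.tendsto_atTop
  have hge : ε ≤ ‖W (-1) 0‖ :=
    ge_of_tendsto hlim.norm (Eventually.of_forall fun j => (hw1 _).le)
  rw [hW0 (-1) (by norm_num) 0, norm_zero] at hge
  exact absurd hge (not_le.2 hε)

end Summit.NavierStokesRegularity.NavierStokesRegularity.Theorems.SymmetryModuliCountSymmetricLiouville

end
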